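import Summits.HodgeConjecture.HodgeConjecture.Theorems.Ring2AbelianAllAndrePrimitiveLiftFibreLefschetzDegreeRows
import Summits.HodgeConjecture.HodgeConjecture.Theorems.Ring2AbelianAllAndreFibreClassEndomorphismSpan
import Literature.AlgebraicGeometry.HodgeTheory.AlgebraicClassesPullbackDimLEThree
import Literature.AlgebraicGeometry.HodgeTheory.HardLefschetzHodgeRiemannOfAnisotropy
import HarnessLib

/-!
# Ring 2 · sub-cell AbelianAll (ALL ABELIAN VARIETIES), André axis, part XXIV-a — LERAY WEIGHTS: THE HARD-LEFSCHETZ PREIMAGE OF PART XXIII-f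
# IS THE TOP-WEIGHT LIFT, AND THE FIBRE-SUPPORTED CLAUSE IS EXACTLY THE LIFT (for data symmetric under a weighted endomorphism)

HONEST FRAMING (page 1, verbatim): **research route, not a corollary; conditional on HC_CM plus one named
minimal statement.** Cell line: research route conditional on HC_CM; not a corollary; Q11.4-sentence-2
already refuted in dim ≥ 3. Nothing in this file proves a case of the Hodge conjecture for an abelian variety; `HC_CM` does not occur in this
file; item `Theses.RankFourFaces.CMToAbelian` (stmt-16267) OPEN and not closed here. Seat `pub-hodge-ring2-ab-andre-2`, gen 16; brief (ii)
"minimise … and re-prove — record each version" and (iii) "attack B_min … smallest open instance stated as a find-the-cycle problem".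

## The question left open by part XXIII (RING2-MAP AA2.124/AA2.125, owed item (o50))

Part XXIII-f reduced the André-axis primitive lift (Prim)_t(p+1) — given the lift (L)_t(p) one degree below — to the FIBRE-SUPPORTED CLAUSE:
for every `κ`-primitive invariant algebraic `ξ ∈ H^{2p+2}(X_t)` the hard-Lefschetz preimage `x_ξ := (L_K^{m+1})⁻¹ j_{t*}(L_κᵐ ξ) ∈ H^{2p+2}(𝒳)`
(`2(p+1)+m = d`) is ALGEBRAIC; and recorded "not known to be equivalent to the lift" (given an algebraic lift `y` of `ξ` one has
`j_{t*} L_κᵐ ξ = [X_t] ∪ Kᵐ ∪ y`, not `K^{m+1} ∪ y`). THIS FILE IDENTIFIES `x_ξ` and settles the question for data symmetric under a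
weighted endomorphism.

## Leray weights (the hypotheses of this file; print THEOREMS for `ν = θ_N`, multiplication by `N` on an abelian scheme)

Let `f : 𝒳 ⟶ S` be a compact pencil of abelian `d`-folds (an abelian scheme over the smooth projective curve `S`, Mumford GIT 6.14) and
`ν : 𝒳 ⟶ 𝒳` an endomorphism. Print (Kleiman 1968 p. 374; Abdulali 1994 p. 1122; Milne 2020, proof of Prop. 1; Deninger–Murre 1991 Thm. 3.1):
for `ν = θ_N`, `θ_N^*` acts as `Nʲ` on `Rʲ f_* ℚ`, the Leray spectral sequence degenerates, `Hᵏ(𝒳) = ⊕_{i+j=k} Hⁱ(S, Rʲ f_*)` with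
`Hⁱ(S, Rʲ f_*)` THE SUBSPACE OF `Hᵏ(𝒳)` ON WHICH `θ_N^*` ACTS AS `Nʲ` (three weights `Nᵏ, N^{k-1}, N^{k-2}` since `dim S = 1`), and
`j_t^* : H⁰(S, Rᵏ f_*) ↪ Hᵏ(X_t)` is injective with image the invariants. We TYPE exactly what is used, as hypotheses on `ν` and `N ≥ 2`:
* (wt)   `j_t^*(ν^* w) = Nᵏ · j_t^* w` for `w ∈ Hᵏ(𝒳)` (weight `k` on the fibre: `θ_N^* = Nᵏ` on `Hᵏ(X_t)`);
* (wt₃)  every `w ∈ Hᵏ(𝒳)` is `w₀ + w₁ + w₂` with `ν^* wᵢ = N^{k-i} wᵢ` (three Leray weights);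
* (top)  a class of top weight `Nᵏ` in `Hᵏ(𝒳)` vanishing on `X_t` is zero (`E_∞^{0,k} = H⁰(S, Rᵏ f_*) ↪ Hᵏ(X_t)`);
* (sym)  `K = k₂ + a·[X_t]` with `ν^* k₂ = N² k₂` — the datum is `ν`-SYMMETRIC modulo the fibre class (for `θ_N`: the class of a symmetric
         relatively ample line bundle plus a multiple of the fibre class; a general ample class has in addition a weight-`1` (Mordell–Weil) component,
         for which see Honest status).
`ν` is also assumed locally quasi-finite (so that `ν^*` preserves algebraic classes by the tree's theorem; `θ_N` is finite).

## What is proved (theorems only; no definition, no named fact, no sorry; `HC_CM` absent)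

§0 Cup algebra on any space: for `K = k₂ + a·F` with `F ∪ F ∪ (·) = 0`: `L_Kʲ(F ∪ w) = L_{k₂}ʲ(F ∪ w)` and
`L_K^{j+1} w = L_{k₂}^{j+1} w + (j+1)a · L_{k₂}ʲ(F ∪ w)` (**`lefschetzPowTo_succ_eq_add_smul`**).
§1 Weights: **`exists_topWeight_lift`** — (wt) ∧ (wt₃): every ALGEBRAIC class `y ∈ N^{p+1}(𝒳)` has an ALGEBRAIC top-weight companion `y₀`
(`ν^* y₀ = N^{2p+2} y₀`) with the same restriction to `X_t` (the weight projector is a polynomial in `ν^*`); **`topWeight_eq_of_map_fiberι_eq`** —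
(top): the top-weight lift of an invariant class is unique ("canonical lift").
§2 THE IDENTIFICATION **`lefschetzPowTo_topWeight_eq_smul_fiberGysin`** — (sym) ∧ (top in degree `d+m+2`): for `y₀` of top weight with
`j_t^* y₀ = ξ` `κ`-primitive, `L_K^{m+1} y₀ = (m+1)a · j_{t*}(L_κᵐ ξ)`. Proof: `L_{k₂}^{m+1} y₀` has top weight `N^{d+m+2}` (`ν^*` is a ring map)
and restricts to `κ^{m+1} ξ = 0`, so it vanishes by (top); the binomial formula of §0 (`[X_t] ∪ [X_t] = 0`) leaves `(m+1)a·[X_t] ∪ K^m y₀ =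
(m+1)a · j_{t*} j_t^*(Kᵐ y₀)`. Hence (**`hardLefschetzPreimage_eq_smul_topWeight`**) `x_ξ = ((m+1)a)⁻¹ · y₀` whenever `ξ ≠ 0` (and then
`(m+1)a ≠ 0` by hard Lefschetz, **`coeff_ne_zero_of_topWeight`**): THE HARD-LEFSCHETZ PREIMAGE OF PART XXIII-f IS THE CANONICAL (TOP-WEIGHT,
i.e. FLAT) LIFT OF `ξ`, RESCALED.
Part XXIV-b (`Ring2AbelianAllAndreWeightLiftExact`) draws the consequences: (L)_t(p+1) ⟹ the fibre-supported clause of part XXIII-f (so the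
sharpest `B_min` candidate of gen 15 is EXACT for symmetric data on weighted pencils), the canonical-lift and dimension forms of the lift.

## Honest status

Nothing here is fact-free progress on `HC_AV`; no node is born; nothing is minimal. The weight package (wt, wt₃, top) is a print theorem for
`θ_N` on every abelian scheme over a curve but is NOT in the tree (it needs the abelian-scheme structure of a compact pencil and the Leray
spectral sequence with its `θ_N`-splitting on the real carriers); it is carried as displayed hypotheses on a supplied `ν`, exactly like a
bracket. (sym) restricts the datum: for a NON-symmetric ample `K = k₂ + k₁ + a[X_t]` (`k₁` of weight `1`) the preimage `x_ξ` acquires weight-`1`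
and weight-`0` corrections solving `u^{m+1} x₁ = -(m+1) uᵐ k₁ x₀` (relative hard Lefschetz inverted on `H¹(S, R^{d+m+1})`), whose algebraicity is
a Künnemann-type statement not addressed here; since the clause is USED for one datum only, the exact candidate reads "the fibre-supported
clause for ONE symmetric datum". NEW EXACT FORMS OF THE LIFT (per pencil with weights, per point, per degree): (L)_t(p) ⟺ the canonical
(top-weight) lifts of the invariant algebraic classes of `X_t` are algebraic ⟺ (part XXIV-b) `dim N^p(𝒳)^{wt 2p} = dim (N^p(X_t) ∩ Im j_t^*)`
(Abdulali's first sandwich inequality (e2) an equality). W₆ (large monodromy, `E`-power fibre): the sevenfold must carry THREE independent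
codimension-`3` algebraic classes of top weight `N⁶` (it always carries `k₂³`): the canonical lifts `w̃₁, w̃₂` of the two Weil classes.

References: Kleiman1968AlgebraicCycles (p. 374, §3); Abdulali1994FamiliesAV (p. 1122); Milne2020HodgeClassesAV (proof of Prop. 1, p. 7);
DeningerMurre1991 (Thm. 3.1); Grothendieck1968 (§3 p. 196); VoisinHodgeI2002 (§6.2.3, Thm. 6.25); VoisinHodgeII2003 (Thm. 4.18, Prop. 9.20);
MumfordGIT (Thm. 6.14); Andre1996Motifs (§6.3).
-/

noncomputable section

set_option linter.dupNamespace false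

namespace Summit.HodgeConjecture.HodgeConjecture.Ring2.AbelianAll

open CategoryTheory AlgebraicGeometry
open Literature.AlgebraicGeometry Literature.AlgebraicGeometry.Motives
open Literature.AlgebraicGeometry.HodgeTheory
open Literature.AlgebraicTopology.SingularHomology (singularCohomology cupProduct cupProduct_map cupProduct_assoc
  cupProduct_gradedComm_holds)
open Literature.Geometry.Kaehler (lefschetzOperator lefschetzPow HasHardLefschetzProperty lefschetzOperator_apply)

/-! ## §0 Cup algebra: the Lefschetz iterates of `K = k₂ + a·F` when `F ∪ F ∪ (·) = 0` -/

section CupAlgebra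

variable {Y : Type*} [TopologicalSpace Y] {K k₂ F : singularCohomology ℂ ℂ Y 2} {a : ℂ}

/-- **`L_Kʲ(F ∪ w) = L_{k₂}ʲ(F ∪ w)`** for `K = k₂ + a·F` when `F ∪ F ∪ (·) = 0`: on classes divisible by `F` the two Lefschetz iterates
agree (the extra term `a·F ∪ F ∪ (·)` dies). [cite: HatcherAT2002, §3.2 p. 211] [cite: VoisinHodgeI2002, §6.2.3] -/
theorem lefschetzPowTo_cup_eq_of_eq_add_smul (hK : K = k₂ + a • F)
    (hFF : ∀ {l l₁ l₂ : ℕ} (h₁ : 2 + l = l₁) (h₂ : 2 + l₁ = l₂) (w : singularCohomology ℂ ℂ Y l),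
      cupProduct h₂ F (cupProduct h₁ F w) = 0) :
    ∀ (j : ℕ) {l l₁ s : ℕ} (h₁ : 2 + l = l₁) (hs : l₁ + 2 * j = s) (w : singularCohomology ℂ ℂ Y l),
      lefschetzPowTo K j l₁ s hs (cupProduct h₁ F w) = lefschetzPowTo k₂ j l₁ s hs (cupProduct h₁ F w)
  | 0, l, l₁, s, h₁, hs, w => by
    subst hs
    rfl
  | j + 1, l, l₁, s, h₁, hs, w => by
    rw [lefschetzPowTo_succ_apply K j l₁ (l₁ + 2 * j) s rfl hs (by omega),
      lefschetzPowTo_succ_apply k₂ j l₁ (l₁ + 2 * j) s rfl hs (by omega),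
      lefschetzPowTo_cup_eq_of_eq_add_smul hK hFF j h₁ rfl w, lefschetzOperator_apply, lefschetzOperator_apply, hK, map_add,
      map_smul, LinearMap.add_apply, LinearMap.smul_apply,
      cupProduct_lefschetzPowTo_right k₂ j (rfl : l₁ + 2 * j = l₁ + 2 * j) (by omega : 2 + (l₁ + 2 * j) = s)
        (rfl : 2 + l₁ = 2 + l₁) (by omega : 2 + l₁ + 2 * j = s) F (cupProduct h₁ F w),
      hFF h₁ rfl w, map_zero, smul_zero, add_zero]

/-- **THE BINOMIAL FORMULA `L_K^{j+1} w = L_{k₂}^{j+1} w + (j+1)a · L_{k₂}ʲ(F ∪ w)`** for `K = k₂ + a·F` when `F ∪ F ∪ (·) = 0` (all classes of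
even degree `2` commute; the terms with `F²` die). [cite: HatcherAT2002, §3.2 p. 211 and Thm. 3.11] [cite: VoisinHodgeI2002, §6.2.3] -/
theorem lefschetzPowTo_succ_eq_add_smul (hK : K = k₂ + a • F)
    (hFF : ∀ {l l₁ l₂ : ℕ} (h₁ : 2 + l = l₁) (h₂ : 2 + l₁ = l₂) (w : singularCohomology ℂ ℂ Y l),
      cupProduct h₂ F (cupProduct h₁ F w) = 0) :
    ∀ (j : ℕ) {l l₁ s : ℕ} (h₁ : 2 + l = l₁) (hs : l + 2 * (j + 1) = s) (hs' : l₁ + 2 * j = s)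
      (w : singularCohomology ℂ ℂ Y l),
      lefschetzPowTo K (j + 1) l s hs w =
        lefschetzPowTo k₂ (j + 1) l s hs w + (((j : ℂ) + 1) * a) • lefschetzPowTo k₂ j l₁ s hs' (cupProduct h₁ F w)
  | 0, l, l₁, s, h₁, hs, hs', w => by
    obtain rfl : l₁ = s := by omega
    rw [lefschetzPowTo_zero_eq_id k₂ hs', LinearMap.id_apply,
      lefschetzPowTo_succ_apply K 0 l l l₁ rfl hs h₁, lefschetzPowTo_succ_apply k₂ 0 l l l₁ rfl hs h₁,
      lefschetzPowTo_zero_apply, lefschetzPowTo_zero_apply, lefschetzOperator_apply, lefschetzOperator_apply, hK,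
      map_add, map_smul, LinearMap.add_apply, LinearMap.smul_apply, Nat.cast_zero, zero_add, one_mul]
  | j + 1, l, l₁, s, h₁, hs, hs', w => by
    have ih := lefschetzPowTo_succ_eq_add_smul hK hFF j h₁ (rfl : l + 2 * (j + 1) = l + 2 * (j + 1))
      (by omega : l₁ + 2 * j = l + 2 * (j + 1)) w
    rw [lefschetzPowTo_succ_apply K (j + 1) l (l + 2 * (j + 1)) s rfl hs (by omega), ih, map_add, map_smul,
      lefschetzOperator_apply, lefschetzOperator_apply]
    -- `K ∪ L_{k₂}^{j+1} w = L_{k₂}^{j+2} w + a · L_{k₂}^{j+1}(F ∪ w)`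
    have e1 : cupProduct (show 2 + (l + 2 * (j + 1)) = s by omega) K
        (lefschetzPowTo k₂ (j + 1) l (l + 2 * (j + 1)) rfl w) =
          lefschetzPowTo k₂ (j + 1 + 1) l s hs w + a • lefschetzPowTo k₂ (j + 1) l₁ s hs' (cupProduct h₁ F w) := by
      rw [hK, map_add, map_smul, LinearMap.add_apply, LinearMap.smul_apply, ← lefschetzOperator_apply k₂,
        ← lefschetzPowTo_succ_apply k₂ (j + 1) l (l + 2 * (j + 1)) s rfl hs,
        cupProduct_lefschetzPowTo_right k₂ (j + 1) (rfl : l + 2 * (j + 1) = l + 2 * (j + 1))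
          (by omega : 2 + (l + 2 * (j + 1)) = s) h₁ hs' F w]
    -- `K ∪ L_{k₂}ʲ(F ∪ w) = L_{k₂}^{j+1}(F ∪ w)` (the `F²`-term dies)
    have e2 : cupProduct (show 2 + (l + 2 * (j + 1)) = s by omega) K
        (lefschetzPowTo k₂ j l₁ (l + 2 * (j + 1)) (by omega) (cupProduct h₁ F w)) =
          lefschetzPowTo k₂ (j + 1) l₁ s hs' (cupProduct h₁ F w) := by
      rw [hK, map_add, map_smul, LinearMap.add_apply, LinearMap.smul_apply, ← lefschetzOperator_apply k₂,
        ← lefschetzPowTo_succ_apply k₂ j l₁ (l + 2 * (j + 1)) s (by omega) hs',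
        cupProduct_lefschetzPowTo_right k₂ j (by omega : l₁ + 2 * j = l + 2 * (j + 1))
          (by omega : 2 + (l + 2 * (j + 1)) = s) (rfl : 2 + l₁ = 2 + l₁) (by omega : 2 + l₁ + 2 * j = s) F
          (cupProduct h₁ F w),
        hFF h₁ rfl w, map_zero, smul_zero, add_zero]
    rw [e1, e2, add_assoc, ← add_smul]
    congr 2
    push_cast
    ring

end CupAlgebra

/-! ## §1 Leray weights: top-weight (canonical) lifts -/

section Weights

variable {𝒳 S : SchemeOver ℂ} {d : ℕ} {f : 𝒳 ⟶ S}

/-- `(N:ℂ)ᵇ - (N:ℂ)ᵃ ≠ 0` for `N ≥ 2` and `a < b`: the Leray weights are pairwise distinct. [folklore] -/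
theorem natCast_pow_sub_pow_ne_zero {N a b : ℕ} (hN : 2 ≤ N) (hab : a < b) : (N : ℂ) ^ b - (N : ℂ) ^ a ≠ 0 := by
  rw [sub_ne_zero, ← Nat.cast_pow, ← Nat.cast_pow, Ne, Nat.cast_inj]
  exact (Nat.pow_lt_pow_right hN hab).ne'

/-- **A class of non-top weight dies on the fibre**: if `j_t^*(ν^* w) = Nᵏ j_t^* w` for all `w ∈ Hᵏ(𝒳)` (weight `k` on the fibre) and
`ν^* w = N^{k'} w` with `k' < k`, then `j_t^* w = 0`. [cite: Milne2020HodgeClassesAV, proof of Prop. 1 (p. 7)] [cite: Kleiman1968AlgebraicCycles, p. 374] -/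
theorem map_fiberι_eq_zero_of_weight_lt (t : ComplexPoints S) (ν : 𝒳 ⟶ 𝒳) {N k k' : ℕ} (hN : 2 ≤ N) (hk' : k' < k)
    (hwt : ∀ w : complexBetti 𝒳 k,
      complexBetti.map (fiberι f t) k (complexBetti.map ν k w) = ((N : ℂ) ^ k) • complexBetti.map (fiberι f t) k w)
    {w : complexBetti 𝒳 k} (hw : complexBetti.map ν k w = ((N : ℂ) ^ k') • w) :
    complexBetti.map (fiberι f t) k w = 0 := by
  have h := hwt w
  rw [hw, map_smul] at h
  have h' : ((N : ℂ) ^ k - (N : ℂ) ^ k') • complexBetti.map (fiberι f t) k w = 0 := by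
    rw [sub_smul, sub_eq_zero]
    exact h.symm
  exact (smul_eq_zero.1 h').resolve_left (natCast_pow_sub_pow_ne_zero hN hk')

/-- **TOP-WEIGHT LIFTS OF ALGEBRAIC LIFTS ARE ALGEBRAIC.** Granted (wt) and (wt₃) in degree `2(p+1)` for a locally quasi-finite endomorphism
`ν` of the compact pencil (`θ_N` in print): every algebraic `y ∈ N^{p+1}(𝒳)` has an algebraic companion `y₀ ∈ N^{p+1}(𝒳)` OF TOP WEIGHT
(`ν^* y₀ = N^{2p+2} y₀`) with `j_t^* y₀ = j_t^* y` — `y₀` is the weight-`(2p+2)` component of `y`, i.e. the Lagrange polynomial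
`(ν^* - N^{2p+1})(ν^* - N^{2p})/((N^{2p+2} - N^{2p+1})(N^{2p+2} - N^{2p}))` applied to `y` (pull-backs preserve algebraic classes), and the
two lower-weight components die on the fibre. [cite: Milne2020HodgeClassesAV, proof of Prop. 1 (p. 7)] [cite: Abdulali1994FamiliesAV, p. 1122]
[cite: DeningerMurre1991, Thm. 3.1] -/
theorem exists_topWeight_lift (hf : IsCompactAbelianPencil f d) (t : ComplexPoints S) (ν : 𝒳 ⟶ 𝒳) [LocallyQuasiFinite ν.left]
    {N : ℕ} (hN : 2 ≤ N) {p : ℕ}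
    (hwt : ∀ w : complexBetti 𝒳 (2 * (p + 1)), complexBetti.map (fiberι f t) (2 * (p + 1)) (complexBetti.map ν (2 * (p + 1)) w) =
      ((N : ℂ) ^ (2 * (p + 1))) • complexBetti.map (fiberι f t) (2 * (p + 1)) w)
    (hwt₃ : ∀ w : complexBetti 𝒳 (2 * (p + 1)), ∃ w₀ w₁ w₂ : complexBetti 𝒳 (2 * (p + 1)), w = w₀ + w₁ + w₂ ∧
      complexBetti.map ν (2 * (p + 1)) w₀ = ((N : ℂ) ^ (2 * (p + 1))) • w₀ ∧
      complexBetti.map ν (2 * (p + 1)) w₁ = ((N : ℂ) ^ (2 * p + 1)) • w₁ ∧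
      complexBetti.map ν (2 * (p + 1)) w₂ = ((N : ℂ) ^ (2 * p)) • w₂)
    {y : complexBetti 𝒳 (2 * (p + 1))} (hy : y ∈ algebraicClasses 𝒳 (p + 1)) :
    ∃ y₀ ∈ algebraicClasses 𝒳 (p + 1), complexBetti.map ν (2 * (p + 1)) y₀ = ((N : ℂ) ^ (2 * (p + 1))) • y₀ ∧
      complexBetti.map (fiberι f t) (2 * (p + 1)) y₀ = complexBetti.map (fiberι f t) (2 * (p + 1)) y := by
  obtain ⟨w₀, w₁, w₂, hsum, h₀, h₁, h₂⟩ := hwt₃ y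
  set T : Module.End ℂ (complexBetti 𝒳 (2 * (p + 1))) := (complexBetti.map ν (2 * (p + 1))).hom with hT
  have hT' : ∀ w, T w = complexBetti.map ν (2 * (p + 1)) w := fun _ ↦ rfl
  set q₀ : ℂ := (N : ℂ) ^ (2 * (p + 1))
  set q₁ : ℂ := (N : ℂ) ^ (2 * p + 1)
  set q₂ : ℂ := (N : ℂ) ^ (2 * p)
  have hc : (q₀ - q₁) * (q₀ - q₂) ≠ 0 :=
    mul_ne_zero (natCast_pow_sub_pow_ne_zero hN (by omega)) (natCast_pow_sub_pow_ne_zero hN (by omega))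
  -- the Lagrange polynomial isolates `w₀`
  have hLag : T (T y) - q₂ • T y - q₁ • (T y - q₂ • y) = ((q₀ - q₁) * (q₀ - q₂)) • w₀ := by
    simp only [hT', hsum, map_add, h₀, h₁, h₂, map_smul, smul_add, smul_smul, smul_sub]
    module
  have halg : ∀ w ∈ algebraicClasses 𝒳 (p + 1), T w ∈ algebraicClasses 𝒳 (p + 1) :=
    fun w hw ↦ map_mem_algebraicClasses_of_endo hf ν hw
  have hw₀alg : w₀ ∈ algebraicClasses 𝒳 (p + 1) := by
    have h : ((q₀ - q₁) * (q₀ - q₂))⁻¹ • (T (T y) - q₂ • T y - q₁ • (T y - q₂ • y)) = w₀ := by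
      rw [hLag, smul_smul, inv_mul_cancel₀ hc, one_smul]
    rw [← h]
    refine Submodule.smul_mem _ _ (Submodule.sub_mem _ (Submodule.sub_mem _ (halg _ (halg _ hy))
      (Submodule.smul_mem _ _ (halg _ hy))) (Submodule.smul_mem _ _ (Submodule.sub_mem _ (halg _ hy) (Submodule.smul_mem _ _ hy))))
  refine ⟨w₀, hw₀alg, h₀, ?_⟩
  rw [hsum, map_add, map_add, map_fiberι_eq_zero_of_weight_lt t ν hN (by omega : 2 * p + 1 < 2 * (p + 1)) hwt h₁,
    map_fiberι_eq_zero_of_weight_lt t ν hN (by omega : 2 * p < 2 * (p + 1)) hwt h₂, add_zero, add_zero]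

/-- **THE TOP-WEIGHT LIFT IS CANONICAL**: granted (top) in degree `k`, two classes of top weight with the same restriction to `X_t` are equal
(the canonical = flat lift of an invariant class). [cite: Milne2020HodgeClassesAV, proof of Prop. 1 (p. 7)] [cite: VoisinHodgeII2003, §4.3.1 Thm. 4.18] -/
theorem topWeight_eq_of_map_fiberι_eq (t : ComplexPoints S) (ν : 𝒳 ⟶ 𝒳) {N k : ℕ}
    (htop : ∀ G : complexBetti 𝒳 k, complexBetti.map ν k G = ((N : ℂ) ^ k) • G → complexBetti.map (fiberι f t) k G = 0 → G = 0)
    {y₀ y₀' : complexBetti 𝒳 k} (h₀ : complexBetti.map ν k y₀ = ((N : ℂ) ^ k) • y₀) (h₀' : complexBetti.map ν k y₀' = ((N : ℂ) ^ k) • y₀')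
    (heq : complexBetti.map (fiberι f t) k y₀ = complexBetti.map (fiberι f t) k y₀') : y₀ = y₀' := by
  rw [← sub_eq_zero]
  exact htop _ (by rw [map_sub, h₀, h₀', smul_sub]) (by rw [map_sub, heq, sub_self])

end Weights

/-! ## §2 THE IDENTIFICATION: `L_K^{m+1}(top-weight lift) = (m+1)a · j_{t*} L_κᵐ ξ` -/

section Identification

variable {𝒳 S : SchemeOver ℂ} {d : ℕ} {f : 𝒳 ⟶ S}

/-- `[X_t] ∪ [X_t] ∪ w = 0` in the degree-`2` spelling of the fibre class (`[X_t] ∪ [X_t] = 0`, part XV-a, and associativity). [cite: Fulton1998, §19.1]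
[cite: HatcherAT2002, §3.2 p. 211] -/
theorem cupProduct_fiberClass_cupProduct_fiberClass_eq_zero (hf : IsCompactAbelianPencil f d) (t : ComplexPoints S)
    {F : complexBetti 𝒳 2} (hF : F = fiberGysin hf t 0 (singularCohomology.one ℂ (ComplexPoints (fiberOver f t))))
    {l l₁ l₂ : ℕ} (h₁ : 2 + l = l₁) (h₂ : 2 + l₁ = l₂) (w : complexBetti 𝒳 l) :
    cupProduct h₂ F (cupProduct h₁ F w) = 0 := by
  have hFF : cupProduct (show 2 + 2 = 4 by rfl) F F = 0 := by
    rw [hF]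
    exact cupProduct_fiberGysin_one_eq_zero hf t t
  rw [← cupProduct_assoc (show 2 + 2 = 4 by rfl) h₁ (show 4 + l = l₂ by omega) h₂ F F w, hFF, map_zero,
    LinearMap.zero_apply]

/-- `j_{t*}(j_t^* W) = [X_t] ∪ W` in the degree-`2`, fibre-class-on-the-left spelling (projection formula, part V, and graded commutativity).
[cite: FultonYoungTableaux1997, Appendix B §B.1 (6)] [cite: HatcherAT2002, Thm. 3.11] -/
theorem fiberGysin_map_fiberι_eq_fiberClass_cupProduct (hf : IsCompactAbelianPencil f d) (t : ComplexPoints S)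
    {F : complexBetti 𝒳 2} (hF : F = fiberGysin hf t 0 (singularCohomology.one ℂ (ComplexPoints (fiberOver f t))))
    {q : ℕ} (W : complexBetti 𝒳 (2 * q)) (h : 2 + 2 * q = 2 * (q + 1)) :
    fiberGysin hf t q (complexBetti.map (fiberι f t) (2 * q) W) = cupProduct h F W := by
  rw [fiberGysin_map_fiberι_eq_cupProduct hf t W,
    cupProduct_gradedComm_holds ℂ (ComplexPoints 𝒳) _ (show 2 * (0 + 1) + 2 * q = 2 * (q + 1) by ring) W,
    Even.neg_one_pow ⟨q * (2 * (0 + 1)), by ring⟩, one_smul, hF]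

/-- `j_t^* k₂ = κ`: the symmetric part of `K = k₂ + a·[X_t]` has the same restriction to the fibre as `K` (`j_t^*[X_t] = 0`, part XV-a).
[cite: Fulton1998, §19.1] -/
theorem map_fiberι_symmPart_eq (hf : IsCompactAbelianPencil f d) (t : ComplexPoints S) {K k₂ F : complexBetti 𝒳 2} {a : ℂ}
    (hF : F = fiberGysin hf t 0 (singularCohomology.one ℂ (ComplexPoints (fiberOver f t)))) (hK : K = k₂ + a • F) :
    complexBetti.map (fiberι f t) 2 k₂ = complexBetti.map (fiberι f t) 2 K := by
  have hFt : complexBetti.map (fiberι f t) 2 F = 0 := by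
    rw [hF]
    exact map_fiberι_fiberGysin_one_eq_zero hf t t
  rw [hK, map_add, map_smul, hFt, smul_zero, add_zero]

/-- **THE IDENTIFICATION.** Let `f : 𝒳 ⟶ S` be a compact pencil of abelian `d`-folds, `t` a point, `ν` an endomorphism of `𝒳`, `N` a
weight base, `K = k₂ + a·[X_t]` a class `ν`-SYMMETRIC modulo the fibre class (`ν^* k₂ = N² k₂`), `2(p+1) + m = d`, and assume (top) in
degree `d+m+2`: a class of weight `N^{d+m+2}` in `H^{d+m+2}(𝒳)` vanishing on `X_t` is zero. Then for every `y₀ ∈ H^{2p+2}(𝒳)` OF TOP WEIGHT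
(`ν^* y₀ = N^{2p+2} y₀`) whose restriction `ξ = j_t^* y₀` is `κ`-PRIMITIVE, **`L_K^{m+1} y₀ = (m+1)a · j_{t*}(L_κᵐ ξ)`**. Proof: `ν^*` is a
ring endomorphism, so `L_{k₂}^{m+1} y₀` has top weight `N^{2m+2} N^{2p+2} = N^{d+m+2}`; it restricts to `κ^{m+1} ξ = 0` (primitivity), hence
vanishes by (top); the binomial formula (§0, `[X_t]² = 0`) gives `L_K^{m+1} y₀ = (m+1)a·L_{k₂}ᵐ([X_t] ∪ y₀) = (m+1)a·[X_t] ∪ L_Kᵐ y₀ =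
(m+1)a · j_{t*} j_t^*(L_Kᵐ y₀)`. For `ν = θ_N` all hypotheses but (sym) are print theorems (Leray weights of an abelian scheme).
[cite: Milne2020HodgeClassesAV, proof of Prop. 1 (p. 7)] [cite: Kleiman1968AlgebraicCycles, p. 374] [cite: DeningerMurre1991, Thm. 3.1]
[cite: VoisinHodgeI2002, §6.2.3 and §7.3.2] -/
theorem lefschetzPowTo_topWeight_eq_smul_fiberGysin (hf : IsCompactAbelianPencil f d) (t : ComplexPoints S) (ν : 𝒳 ⟶ 𝒳) (N : ℕ)
    {K k₂ F : complexBetti 𝒳 2} {a : ℂ} (hF : F = fiberGysin hf t 0 (singularCohomology.one ℂ (ComplexPoints (fiberOver f t))))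
    (hK : K = k₂ + a • F) (hk₂ : complexBetti.map ν 2 k₂ = ((N : ℂ) ^ 2) • k₂) {p m : ℕ} (hpm : 2 * (p + 1) + m = d)
    (htop : ∀ G : complexBetti 𝒳 (2 * (p + 1 + m + 1)),
      complexBetti.map ν (2 * (p + 1 + m + 1)) G = ((N : ℂ) ^ (2 * (p + 1 + m + 1))) • G →
      complexBetti.map (fiberι f t) (2 * (p + 1 + m + 1)) G = 0 → G = 0)
    {y₀ : complexBetti 𝒳 (2 * (p + 1))} (hy₀ : complexBetti.map ν (2 * (p + 1)) y₀ = ((N : ℂ) ^ (2 * (p + 1))) • y₀)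
    (hP : complexBetti.map (fiberι f t) (2 * (p + 1)) y₀ ∈ primitiveClasses (complexBetti.map (fiberι f t) 2 K) d (2 * (p + 1))) :
    lefschetzPowTo K (m + 1) (2 * (p + 1)) (2 * (p + 1 + m + 1)) (by omega) y₀ =
      (((m : ℂ) + 1) * a) • fiberGysin hf t (p + 1 + m)
        (lefschetzPowTo (complexBetti.map (fiberι f t) 2 K) m (2 * (p + 1)) (2 * (p + 1 + m)) (by omega)
          (complexBetti.map (fiberι f t) (2 * (p + 1)) y₀)) := by
  have hFF := fun {l l₁ l₂ : ℕ} (h₁ : 2 + l = l₁) (h₂ : 2 + l₁ = l₂) (w : complexBetti 𝒳 l) ↦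
    cupProduct_fiberClass_cupProduct_fiberClass_eq_zero hf t hF h₁ h₂ w
  have hk₂κ := map_fiberι_symmPart_eq hf t hF hK
  -- `G = L_{k₂}^{m+1} y₀` has top weight and dies on the fibre, hence vanishes
  have hG : lefschetzPowTo k₂ (m + 1) (2 * (p + 1)) (2 * (p + 1 + m + 1)) (by omega) y₀ = 0 := by
    refine htop _ ?_ ?_
    · have he : (N : ℂ) ^ (2 * (p + 1)) * ((N : ℂ) ^ 2) ^ (m + 1) = (N : ℂ) ^ (2 * (p + 1 + m + 1)) := by ring
      rw [map_lefschetzPowTo ν k₂ (m + 1) (2 * (p + 1)) (2 * (p + 1 + m + 1)) _ y₀, hk₂, hy₀, map_smul, lefschetzPowTo_smul,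
        smul_smul, he]
    · rw [map_fiberι_lefschetzPowTo t k₂ (m + 1) (2 * (p + 1)) (2 * (p + 1 + m + 1)) _ y₀, hk₂κ]
      exact lefschetzPowTo_eq_zero_of_mem_primitiveClasses hP _ (by omega)
  rw [lefschetzPowTo_succ_eq_add_smul hK hFF m (show 2 + 2 * (p + 1) = 2 * (p + 1 + 1) by ring)
      (show 2 * (p + 1) + 2 * (m + 1) = 2 * (p + 1 + m + 1) by ring) (show 2 * (p + 1 + 1) + 2 * m = 2 * (p + 1 + m + 1) by ring) y₀,
    hG, zero_add, ← map_fiberι_lefschetzPowTo t K m (2 * (p + 1)) (2 * (p + 1 + m)) _ y₀,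
    fiberGysin_map_fiberι_eq_fiberClass_cupProduct hf t hF _ (show 2 + 2 * (p + 1 + m) = 2 * (p + 1 + m + 1) by ring),
    cupProduct_lefschetzPowTo_right K m (show 2 * (p + 1) + 2 * m = 2 * (p + 1 + m) by ring)
      (show 2 + 2 * (p + 1 + m) = 2 * (p + 1 + m + 1) by ring) (show 2 + 2 * (p + 1) = 2 * (p + 1 + 1) by ring)
      (show 2 * (p + 1 + 1) + 2 * m = 2 * (p + 1 + m + 1) by ring) F y₀,
    lefschetzPowTo_cup_eq_of_eq_add_smul hK hFF m (show 2 + 2 * (p + 1) = 2 * (p + 1 + 1) by ring) _ y₀]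

/-- **`(m+1)a ≠ 0` as soon as `ξ ≠ 0`** (hard Lefschetz for `K` on the `(d+1)`-fold `𝒳`: `L_K^{m+1}` is injective on `H^{2p+2}(𝒳)`,
`2(p+1) + (m+1) = d+1`, while by the identification `L_K^{m+1} y₀ = (m+1)a · j_{t*} L_κᵐ ξ`). In particular a symmetric datum with hard
Lefschetz has `a ≠ 0` (for `θ_N`: an ample class has positive degree on the zero section). [cite: VoisinHodgeI2002, Thm. 6.25]
[cite: Milne2020HodgeClassesAV, proof of Prop. 1 (p. 7)] -/
theorem coeff_ne_zero_of_topWeight (hf : IsCompactAbelianPencil f d) (t : ComplexPoints S) (ν : 𝒳 ⟶ 𝒳) (N : ℕ)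
    {K k₂ F : complexBetti 𝒳 2} {a : ℂ} (hF : F = fiberGysin hf t 0 (singularCohomology.one ℂ (ComplexPoints (fiberOver f t))))
    (hK : K = k₂ + a • F) (hk₂ : complexBetti.map ν 2 k₂ = ((N : ℂ) ^ 2) • k₂) (hHL : HasHardLefschetzProperty K (d + 1))
    {p m : ℕ} (hpm : 2 * (p + 1) + m = d)
    (htop : ∀ G : complexBetti 𝒳 (2 * (p + 1 + m + 1)),
      complexBetti.map ν (2 * (p + 1 + m + 1)) G = ((N : ℂ) ^ (2 * (p + 1 + m + 1))) • G →
      complexBetti.map (fiberι f t) (2 * (p + 1 + m + 1)) G = 0 → G = 0)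
    {y₀ : complexBetti 𝒳 (2 * (p + 1))} (hy₀ : complexBetti.map ν (2 * (p + 1)) y₀ = ((N : ℂ) ^ (2 * (p + 1))) • y₀)
    (hP : complexBetti.map (fiberι f t) (2 * (p + 1)) y₀ ∈ primitiveClasses (complexBetti.map (fiberι f t) 2 K) d (2 * (p + 1)))
    (hne : complexBetti.map (fiberι f t) (2 * (p + 1)) y₀ ≠ 0) : ((m : ℂ) + 1) * a ≠ 0 := by
  intro hc
  have h := lefschetzPowTo_topWeight_eq_smul_fiberGysin hf t ν N hF hK hk₂ hpm htop hy₀ hP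
  rw [hc, zero_smul] at h
  have hinj := (bijective_lefschetzPowTo_of_hasHardLefschetz K hHL (show 2 * (p + 1) + (m + 1) = d + 1 by omega)
    (2 * (p + 1 + m + 1)) (by omega)).1
  have hy : y₀ = 0 := hinj (by rw [h, map_zero])
  exact hne (by rw [hy, map_zero])

/-- **THE HARD-LEFSCHETZ PREIMAGE OF PART XXIII-f IS THE RESCALED CANONICAL LIFT**: under (sym), (top) and hard Lefschetz for `K` on `𝒳`,
if `x ∈ H^{2p+2}(𝒳)` solves the clause equation `L_K^{m+1} x = j_{t*}(L_κᵐ ξ)` for `ξ = j_t^* y₀ ≠ 0`, `y₀` of top weight, then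
`x = ((m+1)a)⁻¹ · y₀`. So the find-the-cycle problem "`x_ξ` algebraic" of RING2-MAP AA2.124/AA2.125 IS "the top-weight (flat) lift of `ξ` is
algebraic". [cite: VoisinHodgeI2002, Thm. 6.25] [cite: Milne2020HodgeClassesAV, proof of Prop. 1 (p. 7)] [cite: DeningerMurre1991, Thm. 3.1] -/
theorem hardLefschetzPreimage_eq_smul_topWeight (hf : IsCompactAbelianPencil f d) (t : ComplexPoints S) (ν : 𝒳 ⟶ 𝒳) (N : ℕ)
    {K k₂ F : complexBetti 𝒳 2} {a : ℂ} (hF : F = fiberGysin hf t 0 (singularCohomology.one ℂ (ComplexPoints (fiberOver f t))))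
    (hK : K = k₂ + a • F) (hk₂ : complexBetti.map ν 2 k₂ = ((N : ℂ) ^ 2) • k₂) (hHL : HasHardLefschetzProperty K (d + 1))
    {p m : ℕ} (hpm : 2 * (p + 1) + m = d)
    (htop : ∀ G : complexBetti 𝒳 (2 * (p + 1 + m + 1)),
      complexBetti.map ν (2 * (p + 1 + m + 1)) G = ((N : ℂ) ^ (2 * (p + 1 + m + 1))) • G →
      complexBetti.map (fiberι f t) (2 * (p + 1 + m + 1)) G = 0 → G = 0)
    {y₀ : complexBetti 𝒳 (2 * (p + 1))} (hy₀ : complexBetti.map ν (2 * (p + 1)) y₀ = ((N : ℂ) ^ (2 * (p + 1))) • y₀)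
    (hP : complexBetti.map (fiberι f t) (2 * (p + 1)) y₀ ∈ primitiveClasses (complexBetti.map (fiberι f t) 2 K) d (2 * (p + 1)))
    (hne : complexBetti.map (fiberι f t) (2 * (p + 1)) y₀ ≠ 0) {x : complexBetti 𝒳 (2 * (p + 1))}
    (hx : lefschetzPowTo K (m + 1) (2 * (p + 1)) (2 * (p + 1 + m + 1)) (by omega) x =
      fiberGysin hf t (p + 1 + m)
        (lefschetzPowTo (complexBetti.map (fiberι f t) 2 K) m (2 * (p + 1)) (2 * (p + 1 + m)) (by omega)
          (complexBetti.map (fiberι f t) (2 * (p + 1)) y₀))) :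
    x = (((m : ℂ) + 1) * a)⁻¹ • y₀ := by
  have hc := coeff_ne_zero_of_topWeight hf t ν N hF hK hk₂ hHL hpm htop hy₀ hP hne
  have h := lefschetzPowTo_topWeight_eq_smul_fiberGysin hf t ν N hF hK hk₂ hpm htop hy₀ hP
  refine (bijective_lefschetzPowTo_of_hasHardLefschetz K hHL (show 2 * (p + 1) + (m + 1) = d + 1 by omega)
    (2 * (p + 1 + m + 1)) (by omega)).1 ?_
  rw [map_smul, h, smul_smul, inv_mul_cancel₀ hc, one_smul, hx]

end Identification



end Summit.HodgeConjecture.HodgeConjecture.Ring2.AbelianAll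

end
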